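import Mathlib.Topology.Homotopy.Lifting
import Mathlib.Topology.Covering.Quotient
import Mathlib.GroupTheory.Index
import Literature.AlgebraicTopology.SingularHomology.HOneProducts
import HarnessLib

/-!
# The fundamental group of a topological group; homomorphisms with finite kernel as coverings

Three classical facts about a topological group `G` with its unit `1` as base point:

* **Eckmann–Hilton** (`Path.Homotopic.mul_cast_trans`, `fromPath_mul`,
  `isMulCommutative_fundamentalGroup_one`): the pointwise product `α · β` of two loops at `1` is
  homotopic to the concatenation `α ⬝ β` and to `β ⬝ α`, so `π₁(G, 1)` is commutative and the
  `n`-th power map `g ↦ gⁿ` of `G` induces the `n`-th power map of `π₁(G, 1)`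
  (`mapOfEq_powMap`). A. Hatcher, *Algebraic Topology* (2002), §3.C, Ex. 5
  (p. 291) / proof of Lemma 3C.3 (in an H-space "`f · g ≃ (f · e)(e · g)`"); the tree's
  `Path.trans_refl_mul_refl_trans`, `Path.Homotopic.mul_mul` (`HOneProducts.lean`).
* **Homomorphisms with finite kernel are covering maps**
  (`isQuotientCoveringMap_monoidHom`): a continuous surjective homomorphism
  `f : G → H` from a compact Hausdorff group onto a Hausdorff group with finite kernel is a
  quotient covering map for the translation action of `ker f` (a closed, hence quotient, map
  with discrete kernel; Mathlib `IsQuotientMap.isQuotientCoveringMap_of_isDiscrete_ker_monoidHom`).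
* **Index of `f_* π₁` is the order of the kernel**
  (`index_range_mapOfEq_monoidHom_eq_natCard_ker`): for such `f` with `G` path connected,
  `[π₁(H, 1) : f_* π₁(G, 1)] = |ker f|` (Hatcher 2002, Prop. 1.32 / Prop. 1.39–1.40: the number
  of sheets of a path-connected covering equals the index of `p_* π₁`, and for a normal covering
  `π₁(X)/p_* π₁(X̃)` is the deck group; Mathlib `IsQuotientCoveringMap.fundamentalGroupToMulOpposite`,
  surjective with kernel `p_* π₁`), and `f_*` is injective (Hatcher Prop. 1.31; Mathlib
  `IsCoveringMap.injective_path_homotopic_map`).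

Applied to the multiplication-by-`n` isogeny of a complex abelian variety `A` (a surjective
homomorphism `A(ℂ) → A(ℂ)` of the compact connected commutative group `A(ℂ)` with finite kernel
`A[n](ℂ)`), these give `[π₁(A(ℂ)) : n π₁(A(ℂ))] = |A[n](ℂ)|` and the torsion-freeness of
`π₁(A(ℂ))` (`pow_injective_fundamentalGroup_of_isCoveringMap`), the topological half of
`b₁(A(ℂ)) = 2 dim A`. Everything here is proved; there are no new definitions besides the
`n`-th power map packaged as a continuous map (`powMap`).

## References

* A. Hatcher, *Algebraic Topology*, CUP 2002, §1.3 Prop. 1.31, Prop. 1.32, Prop. 1.39;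
  §3.C Ex. 5 / Lemma 3C.3. [HatcherAT2002]
-/

noncomputable section

open Function Topology
open Literature.AlgebraicTopology.SingularHomology (Path.trans_refl_mul_refl_trans Path.Homotopic.mul_mul)

universe u v

namespace Literature.AlgebraicTopology.FundamentalGroup

/-! ### Eckmann–Hilton in `π₁(G, 1)` -/

section EckmannHilton

variable {G : Type u} [TopologicalSpace G] [Group G] [IsTopologicalGroup G]

/-- Mirror image of the tree's `Path.trans_refl_mul_refl_trans`: the pointwise product of
`refl ⬝ α` and `β ⬝ refl` is the concatenation of the left translate `a β` and the right translate
`α b` (Hatcher 2002, proof of Lemma 3C.3). [cite: HatcherAT2002, §3.C Lemma 3C.3] -/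
theorem Path.refl_trans_mul_trans_refl {a b : G} (α : Path a a) (β : Path b b) :
    Path.mul ((Path.refl a).trans α) (β.trans (Path.refl b)) =
      (β.map (continuous_const_mul a)).trans (α.map (continuous_mul_const b)) := by
  rw [Path.mul, ← Path.trans_prod_eq_prod_trans, Path.map_trans]
  congr 1

omit [TopologicalSpace G] [IsTopologicalGroup G] in
/-- `1 = 1 * 1` in `G` (the base point of a pointwise product of loops at `1`). [folklore] -/
theorem one_eq_one_mul_one : (1 : G) = 1 * 1 := (mul_one 1).symm

/-- **Eckmann–Hilton for loops**: in a topological group the pointwise product `α · β` of two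
loops at `1` is homotopic to the concatenation `α ⬝ β` (Hatcher 2002, §3.C Ex. 5:
`α · β ≃ (α ⬝ refl) · (refl ⬝ β) = α ⬝ β`). [cite: HatcherAT2002, §3.C Lemma 3C.3] -/
theorem Path.Homotopic.mul_cast_trans (α β : Path (1 : G) 1) :
    ((Path.mul α β).cast one_eq_one_mul_one one_eq_one_mul_one).Homotopic (α.trans β) := by
  have h1 : (Path.mul α β).Homotopic (Path.mul (α.trans (Path.refl 1)) ((Path.refl 1).trans β)) :=
    Path.Homotopic.mul_mul ⟨(Path.Homotopy.transRefl α).symm⟩ ⟨(Path.Homotopy.reflTrans β).symm⟩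
  have h2 := h1.pathCast one_eq_one_mul_one one_eq_one_mul_one
  rw [Path.trans_refl_mul_refl_trans] at h2
  suffices heq : (((α.map (f := fun x => x * 1) (continuous_mul_const (1 : G))).trans
      (β.map (f := fun x => 1 * x) (continuous_const_mul (1 : G)))).cast
      one_eq_one_mul_one one_eq_one_mul_one) = α.trans β by rwa [heq] at h2
  ext t
  rw [Path.cast_coe, Path.trans_apply, Path.trans_apply]
  split_ifs <;> simp

/-- **Eckmann–Hilton for loops, opposite order**: `α · β` is also homotopic to `β ⬝ α`
(Hatcher 2002, §3.C Ex. 5: `α · β ≃ (refl ⬝ α) · (β ⬝ refl) = β ⬝ α`). [cite: HatcherAT2002, §3.C Lemma 3C.3] -/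
theorem Path.Homotopic.mul_cast_trans' (α β : Path (1 : G) 1) :
    ((Path.mul α β).cast one_eq_one_mul_one one_eq_one_mul_one).Homotopic (β.trans α) := by
  have h1 : (Path.mul α β).Homotopic (Path.mul ((Path.refl 1).trans α) (β.trans (Path.refl 1))) :=
    Path.Homotopic.mul_mul ⟨(Path.Homotopy.reflTrans α).symm⟩ ⟨(Path.Homotopy.transRefl β).symm⟩
  have h2 := h1.pathCast one_eq_one_mul_one one_eq_one_mul_one
  rw [Path.refl_trans_mul_trans_refl] at h2
  suffices heq : (((β.map (f := fun x => 1 * x) (continuous_const_mul (1 : G))).trans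
      (α.map (f := fun x => x * 1) (continuous_mul_const (1 : G)))).cast
      one_eq_one_mul_one one_eq_one_mul_one) = β.trans α by rwa [heq] at h2
  ext t
  rw [Path.cast_coe, Path.trans_apply, Path.trans_apply]
  split_ifs <;> simp

/-- **In `π₁(G, 1)` the class of a pointwise product of loops is the product of the classes**:
`[α · β] = [α] [β]` (Hatcher 2002, §3.C Ex. 5). (Mathlib's `FundamentalGroup` multiplies by
`p * q = q ⬝ p`.) [cite: HatcherAT2002, §3.C Lemma 3C.3] -/
theorem fromPath_mul (α β : Path (1 : G) 1) :
    FundamentalGroup.fromPath (Path.Homotopic.Quotient.mk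
        ((Path.mul α β).cast one_eq_one_mul_one one_eq_one_mul_one)) =
      FundamentalGroup.fromPath (Path.Homotopic.Quotient.mk α) *
        FundamentalGroup.fromPath (Path.Homotopic.Quotient.mk β) := by
  rw [FundamentalGroup.mul_def, ← Path.Homotopic.Quotient.mk_trans]
  exact Quotient.sound (Path.Homotopic.mul_cast_trans' α β)

/-- **The fundamental group of a topological group (at `1`) is commutative** (Eckmann–Hilton;
Hatcher 2002, §3.C Ex. 5: `[α][β] = [α · β] = [β][α]`). [cite: HatcherAT2002, §3.C Lemma 3C.3] -/
instance isMulCommutative_fundamentalGroup_one : IsMulCommutative (FundamentalGroup G (1 : G)) where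
  is_comm := ⟨by
    intro p q
    induction p using Quotient.inductionOn with | h α =>
    induction q using Quotient.inductionOn with | h β =>
    change FundamentalGroup.fromPath (Path.Homotopic.Quotient.mk α) *
        FundamentalGroup.fromPath (Path.Homotopic.Quotient.mk β) =
      FundamentalGroup.fromPath (Path.Homotopic.Quotient.mk β) *
        FundamentalGroup.fromPath (Path.Homotopic.Quotient.mk α)
    rw [← fromPath_mul, FundamentalGroup.mul_def, ← Path.Homotopic.Quotient.mk_trans]
    exact Quotient.sound (Path.Homotopic.mul_cast_trans α β)⟩

variable (G) in
/-- The `n`-th power map `g ↦ gⁿ` of a topological group, as a continuous map. [folklore] -/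
def powMap (n : ℕ) : C(G, G) := ⟨fun g => g ^ n, continuous_pow n⟩

/-- `powMap G n g = gⁿ`. [folklore] -/
@[simp] theorem powMap_apply (n : ℕ) (g : G) : powMap G n g = g ^ n := rfl

/-- `powMap G n 1 = 1`. [folklore] -/
theorem powMap_one (n : ℕ) : powMap G n 1 = 1 := one_pow n

/-- The loop `t ↦ γ(t)ⁿ⁺¹` is the pointwise product of `t ↦ γ(t)ⁿ` and `γ` (as loops at `1`).
[folklore] -/
theorem Path.map_powMap_succ_cast (γ : Path (1 : G) 1) (n : ℕ) :
    (γ.map (powMap G (n + 1)).continuous).cast (powMap_one (n + 1)).symm (powMap_one (n + 1)).symm =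
      (Path.mul ((γ.map (powMap G n).continuous).cast (powMap_one n).symm (powMap_one n).symm) γ).cast
        one_eq_one_mul_one one_eq_one_mul_one := by
  ext t
  change powMap G (n + 1) (γ t) = powMap G n (γ t) * γ t
  simp [pow_succ]

/-- **The `n`-th power map of `G` induces the `n`-th power map of `π₁(G, 1)`**: `(g ↦ gⁿ)_* [γ] = [γ]ⁿ`
(induction on `n` with Eckmann–Hilton, `γⁿ⁺¹ = γⁿ · γ ≃ γⁿ ⬝ γ`; Hatcher 2002, §3.C Ex. 5).
[cite: HatcherAT2002, §3.C Lemma 3C.3] -/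
theorem mapOfEq_powMap (n : ℕ) (p : FundamentalGroup G (1 : G)) :
    FundamentalGroup.mapOfEq (powMap G n) (powMap_one n) p = p ^ n := by
  induction p using Quotient.inductionOn with | h γ =>
  change FundamentalGroup.mapOfEq (powMap G n) (powMap_one n)
    (FundamentalGroup.fromPath (Path.Homotopic.Quotient.mk γ)) =
      FundamentalGroup.fromPath (Path.Homotopic.Quotient.mk γ) ^ n
  rw [FundamentalGroup.mapOfEq_apply]
  change FundamentalGroup.fromPath (((Path.Homotopic.Quotient.mk γ).map (powMap G n)).cast
    (powMap_one n).symm (powMap_one n).symm) = _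
  rw [← Path.Homotopic.Quotient.mk_map, ← Path.Homotopic.Quotient.mk_cast]
  induction n with
  | zero =>
    rw [pow_zero, FundamentalGroup.one_def]
    change FundamentalGroup.fromPath _ = FundamentalGroup.fromPath (Path.Homotopic.Quotient.mk (Path.refl 1))
    congr 2
    ext t
    change powMap G 0 (γ t) = (Path.refl (1 : G)) t
    simp
  | succ n ih =>
    rw [Path.map_powMap_succ_cast, fromPath_mul, ih, pow_succ]

end EckmannHilton

/-! ### Covering maps: injectivity of `p_*`; homomorphisms with finite kernel -/

section Covering

/-- **A covering map induces an injection on fundamental groups** (Hatcher 2002, Prop. 1.31;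
Mathlib's `IsCoveringMap.injective_path_homotopic_map` on Hom-sets of the fundamental groupoid,
transported through the base-point cast of `FundamentalGroup.mapOfEq`). [cite: HatcherAT2002, §1.3 Prop. 1.31] -/
theorem IsCoveringMap.mapOfEq_injective {E : Type u} {X : Type v} [TopologicalSpace E]
    [TopologicalSpace X] {p : E → X} (cov : IsCoveringMap p) {e : E} {x : X} (h : p e = x) :
    Injective (FundamentalGroup.mapOfEq ⟨p, cov.continuous⟩ h) := by
  subst h
  intro γ γ' hγ
  rw [FundamentalGroup.mapOfEq_apply, FundamentalGroup.mapOfEq_apply,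
    Path.Homotopic.Quotient.cast_rfl_rfl, Path.Homotopic.Quotient.cast_rfl_rfl] at hγ
  exact cov.injective_path_homotopic_map e e hγ

/-- If the `n`-th power map `g ↦ gⁿ` of a topological group is a covering map, then `π₁(G, 1)` has
no `n`-torsion: `x ↦ xⁿ` is injective on `π₁(G, 1)` (covering maps are injective on `π₁`,
Hatcher Prop. 1.31, and `(g ↦ gⁿ)_*` is the `n`-th power, Eckmann–Hilton). [cite: HatcherAT2002, §1.3 Prop. 1.31] -/
theorem pow_injective_fundamentalGroup_of_isCoveringMap {G : Type u} [TopologicalSpace G]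
    [Group G] [IsTopologicalGroup G] (n : ℕ) (cov : IsCoveringMap fun g : G => g ^ n) :
    Injective fun p : FundamentalGroup G (1 : G) => p ^ n := by
  have h := IsCoveringMap.mapOfEq_injective (p := fun g : G => g ^ n) cov (e := 1) (one_pow n)
  intro p q hpq
  apply h
  change FundamentalGroup.mapOfEq (powMap G n) (powMap_one n) p =
    FundamentalGroup.mapOfEq (powMap G n) (powMap_one n) q
  rw [mapOfEq_powMap, mapOfEq_powMap]
  exact hpq

variable {G : Type u} {H : Type v} [TopologicalSpace G] [Group G]
  [TopologicalSpace H] [Group H]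

/-- **A continuous surjective homomorphism with finite kernel from a compact Hausdorff group onto
a Hausdorff group is a (quotient) covering map** for the translation action of its kernel: it is a
closed map, hence a quotient map, and its kernel is a finite subset of a Hausdorff space, hence
discrete (Mathlib `IsQuotientMap.isQuotientCoveringMap_of_isDiscrete_ker_monoidHom`; compare
Hatcher 2002, §1.3 Ex. 23–24 / Prop. 1.40 on covering space actions). [folklore] -/
theorem isQuotientCoveringMap_monoidHom [IsTopologicalGroup G] [CompactSpace G] [T2Space G] [T2Space H]
    (f : G →* H) (hf : Continuous f) (hsurj : Surjective f) (hker : (f.ker : Set G).Finite) :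
    IsQuotientCoveringMap f f.ker :=
  (hf.isClosedMap.isQuotientMap hf hsurj).isQuotientCoveringMap_of_isDiscrete_ker_monoidHom
    hker.isDiscrete

/-- Under the same hypotheses, `f` is a covering map. [folklore] -/
theorem isCoveringMap_monoidHom [IsTopologicalGroup G] [CompactSpace G] [T2Space G] [T2Space H]
    (f : G →* H) (hf : Continuous f) (hsurj : Surjective f) (hker : (f.ker : Set G).Finite) :
    IsCoveringMap f :=
  (isQuotientCoveringMap_monoidHom f hf hsurj hker).isCoveringMap

/-- **`[π₁(H, 1) : f_* π₁(G, 1)] = |ker f|`** for a continuous surjective homomorphism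
`f : G → H` with finite kernel from a compact, Hausdorff, path-connected group onto a Hausdorff
group: `f` is a normal (regular) covering with deck group `ker f` acting simply transitively on
the fibre, the monodromy gives a surjection `π₁(H, 1) → (ker f)ᵒᵖ` (path-connectedness of `G`) whose
kernel is `f_* π₁(G, 1)` (Hatcher 2002, Prop. 1.32 and Prop. 1.39; Mathlib
`IsQuotientCoveringMap.fundamentalGroupToMulOpposite`). [cite: HatcherAT2002, §1.3 Prop. 1.39] -/
theorem index_range_mapOfEq_monoidHom_eq_natCard_ker [IsTopologicalGroup G] [CompactSpace G] [T2Space G] [T2Space H]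
    [PathConnectedSpace G] (f : G →* H) (hf : Continuous f) (hsurj : Surjective f)
    (hker : (f.ker : Set G).Finite) :
    (FundamentalGroup.mapOfEq (⟨f, hf⟩ : C(G, H)) (map_one f)).range.index = Nat.card f.ker := by
  have hp := isQuotientCoveringMap_monoidHom f hf hsurj hker
  let e : (f : G → H) ⁻¹' {1} := ⟨1, by simp⟩
  have hkerπ : (hp.fundamentalGroupToMulOpposite e).ker =
      (FundamentalGroup.mapOfEq (⟨f, hf⟩ : C(G, H)) (map_one f)).range := by
    rw [hp.ker_fundamentalGroupToMulOpposite, hp.ker_monodromyPerm e]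
  rw [← hkerπ, Subgroup.index_ker,
    MonoidHom.range_eq_top.mpr (hp.fundamentalGroupToMulOpposite_surjective e), Subgroup.card_top]
  exact Nat.card_congr (MulOpposite.opEquiv (α := f.ker)).symm

/-- **`f_* : π₁(G, 1) → π₁(H, 1)` is injective** for `f` as above (a covering map; Hatcher 2002,
Prop. 1.31). [cite: HatcherAT2002, §1.3 Prop. 1.31] -/
theorem mapOfEq_monoidHom_injective [IsTopologicalGroup G] [CompactSpace G] [T2Space G] [T2Space H]
    (f : G →* H) (hf : Continuous f) (hsurj : Surjective f) (hker : (f.ker : Set G).Finite) :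
    Injective (FundamentalGroup.mapOfEq (⟨f, hf⟩ : C(G, H)) (map_one f)) :=
  IsCoveringMap.mapOfEq_injective (isCoveringMap_monoidHom f hf hsurj hker) (map_one f)

end Covering

/-! ### The `n`-th power map of a compact connected commutative group -/

section Pow

variable {G : Type u} [TopologicalSpace G] [CommGroup G] [IsTopologicalGroup G]

/-- **`[π₁(G, 1) : {xⁿ}] = |G[n]|`**: for a compact Hausdorff path-connected commutative group
whose `n`-th power map `g ↦ gⁿ` is surjective with finite kernel `G[n]`, the subgroup of `n`-th
powers of the (commutative) group `π₁(G, 1)` — the image of `(g ↦ gⁿ)_*` by Eckmann–Hilton — has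
index `|G[n]|` (Hatcher 2002, Prop. 1.39 applied to the covering `g ↦ gⁿ`). For a complex abelian
variety this is `[π₁(A(ℂ)) : n π₁(A(ℂ))] = |A[n](ℂ)| = n^{2 dim A}`. [cite: HatcherAT2002, §1.3 Prop. 1.39] -/
theorem index_range_powMonoidHom_fundamentalGroup [CompactSpace G] [T2Space G] [PathConnectedSpace G] (n : ℕ) (hsurj : Surjective fun g : G => g ^ n)
    (hker : ((powMonoidHom n : G →* G).ker : Set G).Finite) :
    (FundamentalGroup.mapOfEq (powMap G n) (powMap_one n)).range.index =
      Nat.card (powMonoidHom n : G →* G).ker := by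
  have h := index_range_mapOfEq_monoidHom_eq_natCard_ker (powMonoidHom n : G →* G) (continuous_pow n) hsurj hker
  exact h

/-- The range of `(g ↦ gⁿ)_*` on `π₁(G, 1)` is the set of `n`-th powers (Eckmann–Hilton).
[cite: HatcherAT2002, §3.C Lemma 3C.3] -/
theorem mem_range_mapOfEq_powMap_iff (n : ℕ) (q : FundamentalGroup G (1 : G)) :
    q ∈ (FundamentalGroup.mapOfEq (powMap G n) (powMap_one n)).range ↔ ∃ p, p ^ n = q := by
  simp only [MonoidHom.mem_range, mapOfEq_powMap]

/-- **`π₁(G, 1)` has no `n`-torsion** when `g ↦ gⁿ` is surjective with finite kernel on the compact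
Hausdorff commutative group `G` (it is then a covering map, injective on `π₁`, and induces the
`n`-th power; Hatcher 2002, Prop. 1.31). [cite: HatcherAT2002, §1.3 Prop. 1.31] -/
theorem pow_injective_fundamentalGroup [CompactSpace G] [T2Space G] (n : ℕ) (hsurj : Surjective fun g : G => g ^ n)
    (hker : ((powMonoidHom n : G →* G).ker : Set G).Finite) :
    Injective fun p : FundamentalGroup G (1 : G) => p ^ n :=
  pow_injective_fundamentalGroup_of_isCoveringMap n
    (isCoveringMap_monoidHom (powMonoidHom n : G →* G) (continuous_pow n) hsurj hker)

end Pow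

end Literature.AlgebraicTopology.FundamentalGroup

end
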